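import Mathlib
import HarnessLib
import Literature.AlgebraicGeometry.Resolution.BlowupStrictTransform
import Summits.ResolutionOfSingularities.ResolutionOfSingularities.Theorems.WildQuotientsWildQuotientResolutionPrincipalChartRees
import Summits.ResolutionOfSingularities.ResolutionOfSingularities.Theorems.WildQuotientsWildQuotientResolutionToricExitChartASections

/-!
# ℤ9 SPECIMEN (peeled `𝔸⁴/ℤ9`, char 3), brick Z3 part 2a: transport of Rees charts under the lifted
# action and the conjugate `μ₄`-charts `D₊((x_b + m x_a)⁷ t)` (tools for the stable cover, part 2b)
(crux stmt-ResolutionOfSingularities-15640 `WildQuotients.WildQuotientResolution`, line `Sketch`; S1 =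
stmt-ResolutionOfSingularities-17941 `CyclicQuotientFourfolds`, non-linear sector; chain w45c card P specimen
«peeled 𝔸⁴/ℤ9» — res-L1-w45c-idea-2 memo `L/res-L1-w45c-idea-2/cardP_g12/Z9-SPECIMEN.md` §2 «COVER BY STABLE
PIECES» / §4 brick Z3 and `cardP_g12/Z4T-TWIST.md` §1 (`P_T = D₊(N₁⁷t³) = D₊(x_b⁷t) ∩ {u invertible}`),
res-L1-w45c-plan-1 GO 2026-08-27T16:29:20Z, CLARIFICATION 16:29:52Z, ORDER 16:36:47Z («use exactly that piece …
post the three piece NAMES»). [OURS · L1 W4.5c] — NOT a statement of any manuscript; replaces the role of no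
printed item; AI-produced, weaker than expert review. Def-free. Prover res-D-pv-033.)

`V = Bl_{I₂₈} 𝔸ⁿ = Proj k[x][I₂₈ t]` for the abstract generator vector `g : Fin 24 → k[x]` with the exponent table
of record (`…Z9PeeledI28Stable`), `σ̄ x_a = x_a`, `σ̄ x_b = x_b + x_a` (letters `h0 hb`; the laws on `x_c`, `x_d`
and the passengers are not used here), `ρ` any action of `⟨σ̄⟩` on `𝔸ⁿ` with the affine-quotient law, `hJ`
ABSTRACT, `L γ := (affineBlowup.isBlowup I₂₈).liftAction ρ hJ γ` the lifted action. THE THREE PIECES OF RECORD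
(names for Z4a / Z4T / Z4b / Z5 / Z6 consumers; all three are `⟨σ̄⟩`-stable affine opens of `V`):
* `P₀ := D₊(g 0 · t) = D₊(x_a⁴ t)` — the `μ₇`-vertex chart, stable by itself (`…CoverThree`,
  `preimage_vertexChartA_eq`; Proj spelling `preimage_vertexChartA_eq'` below);
* `P_T := ⨅ γ, (L γ)⁻¹ D₊(g 16 · t)` — the orbit intersection of the `μ₄`-vertex chart `D₊(x_b⁷t)`; by
  `preimage_vertexChartB_eq` it is `D₊(x_b⁷t) ∩ D₊((x_b+x_a)⁷t) ∩ D₊((x_b−x_a)⁷t) = D₊(N₁⁷ t³)` (idea-2's piece;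
  the identification as ONE basic open of the invariant norm element is in the Z4-files that need it);
* `P₂ := ⨅ γ, (L γ)⁻¹ D₊(g 23 · t)` — the orbit intersection of the smooth vertex chart `D₊(x_c²⁸t)`
  (`= D₊(N₂²⁸ t³)`, `N₂ = x_c·σ̄x_c·σ̄²x_c`, likewise).
Stability and affineness of `P_T`, `P₂` are the tree's generic `ToricExit.preimage_iInf_preimage_eq` /
`IsAffineOpen.iInf` (`pieceT_stable`, `isAffineOpen_pieceT`, …).

THE STABLE COVER **`vertexChartA_sup_pieceT_sup_pieceC_eq_top : P₀ ⊔ P_T ⊔ P₂ = ⊤`** — by the vertex cover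
(`iSup_vertexCharts_eq_top`, part 1) and ONE cheap Rees identity: for `γ ∈ ⟨σ̄⟩`, `γ⁻¹·x_b = x_b + m x_a`
(`exists_smul_X_b_eq`), the transported chart is `(L γ)⁻¹ D₊(x_b⁷t) = D₊((x_b + m x_a)⁷ t)`
(`BlowupExit.preimage_basicOpen_reesT_liftAction`, generic: `(L γ)⁻¹ D₊(bt) = D₊((γ⁻¹·b)t)`), and on the
complement of `P₀` (`x_a⁴t ∈ 𝔭`) one has `(x_b + m x_a)⁷ t ≡ x_b⁷ t (mod 𝔭)`
(`(x_b + m x_a)⁷ = x_b⁷ + 7m·x_ax_b⁶ + 21m²x_b·x_a²x_b⁴ + 35m³x_b²·x_a³x_b² + (…)·x_a⁴` with `x_ax_b⁶t`,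
`x_a²x_b⁴t`, `x_a³x_b²t ∈ 𝔭` from `(x_a³x_b²t)² = (x_a⁴t)(x_a²x_b⁴t)`, `(x_a²x_b⁴t)² = (x_a⁴t)(x_b⁷·x_b t)`,
`(x_ax_b⁶t)⁴ = (x_a⁴t)(x_b⁷t)³x_b³`; `mem_basicOpen_conj_iff`). Hence off `P₀`: a point of `D₊(x_b⁷t)` has its
whole orbit there (`⇒ P_T`), and a point outside `D₊(x_b⁷t)` has its whole orbit outside `P₀ ∪ D₊(x_b⁷t)`,
i.e. inside `D₊(x_c²⁸t)` (`⇒ P₂`). No degree-`28` expansion is needed.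
-/

-- single-problem summit: the doubled namespace component `ResolutionOfSingularities` is forced
set_option linter.dupNamespace false

noncomputable section

open CategoryTheory AlgebraicGeometry TopologicalSpace MvPolynomial Polynomial
open scoped Pointwise
open Literature.AlgebraicGeometry.Resolution

universe u

namespace Summit.ResolutionOfSingularities.ResolutionOfSingularities.Theorems.WildQuotientResolution

namespace BlowupExit

/-- **Transport of a principal chart along an equivariant square**: for a blow-up `π : X' → X` along `I`
(`X` affine), `α : X' ≅ X'` over `β : X ≅ X` (`α ≫ π = π ≫ β`) with `β⁻¹ I = I`, and `b ∈ I(X)`: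
`α⁻¹ X'[X, b] = X'[X, β^* b]` (the generator need not be invariant; cf.
`ToricExit.preimage_blowupChart_eq_self`). [folklore] -/
theorem preimage_blowupChart_eq_blowupChart_appTop {X X' : Scheme.{u}} [IsAffine X]
    {I : X.IdealSheafData} {π : X' ⟶ X} (hπ : IsBlowup π I) (α : X' ≅ X') (β : X ≅ X)
    (hequiv : α.hom ≫ π = π ≫ β.hom) (hI : I.comap β.hom = I)
    {b : Γ(X, ⊤)} (hb : b ∈ I.ideal ⟨⊤, isAffineOpen_top X⟩) :
    α.hom ⁻¹ᵁ blowupChart π I ⟨⊤, isAffineOpen_top X⟩ b =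
      blowupChart π I ⟨⊤, isAffineOpen_top X⟩ (β.hom.appTop b) := by
  have hρ : IsBlowup π (I.comap β.hom) := by rw [hI]; exact hπ
  rw [preimage_blowupChart_eq hπ hρ hequiv ⟨⊤, isAffineOpen_top X⟩ hb]
  have hg' : β.hom.appLE ⊤ (β.hom ⁻¹ᵁ ⊤) le_rfl b = β.hom.appTop b := by
    rw [Scheme.Hom.appLE_eq_app]; rfl
  have key : ∀ (J : X.IdealSheafData) (_ : J = I) (b' : Γ(X, ⊤)) (_ : b' = β.hom.appTop b),
      blowupChart π J (preimageAffineOpens β.hom ⟨⊤, isAffineOpen_top X⟩) b' =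
        blowupChart π I ⟨⊤, isAffineOpen_top X⟩ (β.hom.appTop b) := by
    rintro J rfl b' rfl
    rfl
  exact key _ hI _ hg'

/-- **Transport of a Rees chart under the lifted action** (affine-quotient law `ρ g = Spec (g⁻¹)`):
`(liftAction ρ hJ g)⁻¹ D₊(b t) = D₊((g⁻¹ • b) t)` on `Bl_I(Spec R)`. [folklore] -/
theorem preimage_basicOpen_reesT_liftAction {R : Type u} [CommRing R] {G : Type*} [Group G]
    [MulSemiringAction G R] (ρ : G →* Aut (Spec (CommRingCat.of R)))
    (hρ : ∀ g : G, (ρ g).hom = Spec.map (CommRingCat.ofHom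
      ((MulSemiringAction.toRingEquiv G R g⁻¹ : R ≃+* R) : R →+* R)))
    {I : Ideal R}
    (hJ : ∀ g : G, (affineBlowup.idealSheaf I).comap (ρ g).hom = affineBlowup.idealSheaf I)
    {b : R} (hb : b ∈ I) (g : G) (hgb : g⁻¹ • b ∈ I) :
    ((affineBlowup.isBlowup I).liftAction ρ hJ g).hom ⁻¹ᵁ Proj.basicOpen (reesGrading I) (reesT b hb) =
      Proj.basicOpen (reesGrading I) (reesT (g⁻¹ • b) hgb) := by
  rw [← ToricExit.blowupChart_affineBlowup_eq_basicOpen_reesT b hb,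
    ← ToricExit.blowupChart_affineBlowup_eq_basicOpen_reesT (g⁻¹ • b) hgb,
    preimage_blowupChart_eq_blowupChart_appTop (affineBlowup.isBlowup I) _ (ρ g)
      ((affineBlowup.isBlowup I).liftAction_hom_comp ρ hJ g) (hJ g)
      (ToricExit.ΓSpecIso_inv_mem_idealSheaf_ideal_top b hb),
    ToricExit.specAction_appTop_ΓSpecIso_inv_smul ρ hρ b g]

end BlowupExit

namespace Z9Peeled

variable (k : Type) [Field k] (n : ℕ) (a b c : Fin n)

/-- The exponent table of the 24 generators of `I₂₈` (memo §1 order; local shorthand used only inside theorem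
signatures). -/
local notation3 "e24" => (![(4, 0, 0), (3, 2, 0), (3, 1, 3), (3, 0, 7), (2, 4, 0), (2, 3, 2), (2, 2, 6), (2, 1, 10), (2, 0, 14), (1, 6, 0), (1, 5, 1), (1, 4, 5), (1, 3, 9), (1, 2, 13), (1, 1, 17), (1, 0, 21), (0, 7, 0), (0, 6, 4), (0, 5, 8), (0, 4, 12), (0, 3, 16), (0, 2, 20), (0, 1, 24), (0, 0, 28)] : Fin 24 → ℕ × ℕ × ℕ)

/-! ## The conjugates of `x_b` and the one Rees identity -/

section Conj

variable (σ : MvPolynomial (Fin n) k ≃ₐ[k] MvPolynomial (Fin n) k)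
  (h0 : σ (X a) = X a) (hb : σ (X b) = X b + X a)

include h0 hb in
/-- Every power of `σ̄` fixes `x_a` and translates `x_b` by a multiple of `x_a`: `σ̄ᶻ x_b = x_b + z·x_a`.
[folklore] -/
theorem zpow_apply_X_b (z : ℤ) :
    (σ ^ z) (X a) = X a ∧ (σ ^ z) (X b) = X b + MvPolynomial.C (z : k) * (X a : MvPolynomial (Fin n) k) := by
  have ha' : σ.symm (X a) = X a := by
    conv_lhs => rw [← h0]
    exact σ.symm_apply_apply _
  have hb' : σ.symm (X b) = X b - X a := by
    have h := σ.symm_apply_apply (X b)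
    rw [hb, map_add, ha'] at h
    linear_combination h
  induction z using Int.induction_on with
  | zero => simp
  | succ i ih =>
    obtain ⟨iha, ihb⟩ := ih
    rw [zpow_add_one]
    refine ⟨?_, ?_⟩
    · rw [AlgEquiv.mul_apply, h0, iha]
    · rw [AlgEquiv.mul_apply, hb, map_add, ihb, iha]
      push_cast
      rw [map_add, map_one]
      ring
  | pred i ih =>
    obtain ⟨iha, ihb⟩ := ih
    rw [zpow_sub_one]
    refine ⟨?_, ?_⟩
    · rw [AlgEquiv.mul_apply, AlgEquiv.aut_inv, ha', iha]
    · rw [AlgEquiv.mul_apply, AlgEquiv.aut_inv, hb', map_sub, ihb, iha]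
      push_cast
      rw [map_sub, map_one]
      ring

include h0 hb in
/-- For `γ ∈ ⟨σ̄⟩` there is `m ∈ k` with `γ • x_a = x_a` and `γ • x_b = x_b + m·x_a`. [folklore] -/
theorem exists_smul_X_b_eq (γ : Subgroup.zpowers σ) :
    ∃ m : k, γ • (X a : MvPolynomial (Fin n) k) = X a ∧
      γ • (X b : MvPolynomial (Fin n) k) = X b + MvPolynomial.C m * X a := by
  obtain ⟨z, hz⟩ := Subgroup.mem_zpowers_iff.mp γ.2
  obtain ⟨hza, hzb⟩ := zpow_apply_X_b k n a b σ h0 hb z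
  refine ⟨(z : k), ?_, ?_⟩
  · change (γ : MvPolynomial (Fin n) k ≃ₐ[k] MvPolynomial (Fin n) k) (X a) = X a
    rw [← hz]; exact hza
  · change (γ : MvPolynomial (Fin n) k ≃ₐ[k] MvPolynomial (Fin n) k) (X b) = _
    rw [← hz]; exact hzb

/-- **The one identity**: `(x_b + m x_a)⁷ = x_b⁷ + 7m·(x_ax_b⁶) + 21m²x_b·(x_a²x_b⁴) + 35m³x_b²·(x_a³x_b²) +
(35m⁴x_b³ + 21m⁵x_ax_b² + 7m⁶x_a²x_b + m⁷x_a³)·x_a⁴` — in the tabulated generators `g 16, g 9, g 4, g 1, g 0`.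
[folklore] -/
theorem add_C_mul_pow_seven_eq (g : Fin 24 → MvPolynomial (Fin n) k)
    (hg : ∀ q, g q = X a ^ (e24 q).1 * X b ^ (e24 q).2.1 * X c ^ (e24 q).2.2) (m : k) :
    (X b + MvPolynomial.C m * X a : MvPolynomial (Fin n) k) ^ 7 =
      g 16 + (7 * MvPolynomial.C m) * g 9 + (21 * MvPolynomial.C m ^ 2 * X b) * g 4 + (35 * MvPolynomial.C m ^ 3 * X b ^ 2) * g 1 +
        (35 * MvPolynomial.C m ^ 4 * X b ^ 3 + 21 * MvPolynomial.C m ^ 5 * X a * X b ^ 2 + 7 * MvPolynomial.C m ^ 6 * X a ^ 2 * X b +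
          MvPolynomial.C m ^ 7 * X a ^ 3) * g 0 := by
  have hg0 : g 0 = X a ^ 4 * X b ^ 0 * X c ^ 0 := hg 0
  have hg1 : g 1 = X a ^ 3 * X b ^ 2 * X c ^ 0 := hg 1
  have hg4 : g 4 = X a ^ 2 * X b ^ 4 * X c ^ 0 := hg 4
  have hg9 : g 9 = X a ^ 1 * X b ^ 6 * X c ^ 0 := hg 9
  have hg16 : g 16 = X a ^ 0 * X b ^ 7 * X c ^ 0 := hg 16
  rw [hg0, hg1, hg4, hg9, hg16]
  ring

/-- `(x_b + m x_a)⁷ ∈ I₂₈`. [folklore] -/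
theorem add_C_mul_pow_seven_mem (g : Fin 24 → MvPolynomial (Fin n) k)
    (hg : ∀ q, g q = X a ^ (e24 q).1 * X b ^ (e24 q).2.1 * X c ^ (e24 q).2.2) (m : k) :
    (X b + MvPolynomial.C m * X a : MvPolynomial (Fin n) k) ^ 7 ∈ Ideal.span (Set.range g) := by
  have hm : ∀ q, g q ∈ Ideal.span (Set.range g) := fun q => Ideal.subset_span ⟨q, rfl⟩
  rw [add_C_mul_pow_seven_eq k n a b c g hg m]
  refine Ideal.add_mem _ (Ideal.add_mem _ (Ideal.add_mem _ (Ideal.add_mem _ (hm 16)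
    (Ideal.mul_mem_left _ _ (hm 9))) (Ideal.mul_mem_left _ _ (hm 4))) (Ideal.mul_mem_left _ _ (hm 1)))
    (Ideal.mul_mem_left _ _ (hm 0))

include h0 hb in
/-- `γ⁻¹ • g 16 = (x_b + m x_a)⁷` for the `m` of `exists_smul_X_b_eq` (`g 16 = x_b⁷`). [folklore] -/
theorem exists_inv_smul_g16_eq (g : Fin 24 → MvPolynomial (Fin n) k)
    (hg : ∀ q, g q = X a ^ (e24 q).1 * X b ^ (e24 q).2.1 * X c ^ (e24 q).2.2)
    (γ : Subgroup.zpowers σ) :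
    ∃ m : k, γ⁻¹ • g 16 = (X b + MvPolynomial.C m * X a : MvPolynomial (Fin n) k) ^ 7 := by
  obtain ⟨m, -, hmb⟩ := exists_smul_X_b_eq k n a b σ h0 hb γ⁻¹
  have hg16 : g 16 = X a ^ 0 * X b ^ 7 * X c ^ 0 := hg 16
  refine ⟨m, ?_⟩
  rw [hg16, pow_zero, pow_zero, one_mul, mul_one, smul_pow', hmb]

end Conj

/-! ## Off `P₀` the conjugate `μ₄`-charts coincide with `D₊(x_b⁷ t)` -/

section ConjChart

variable (g : Fin 24 → MvPolynomial (Fin n) k)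

/-- the Rees generator `g_j t` -/
local notation3 (prettyPrint := false) "gT" j =>
  reesT (I := Ideal.span (Set.range g)) (g j) (Ideal.mem_span_range_self (f := g) (x := j))

/-- **Off the `x_a`-vertex chart, `D₊((x_b + m x_a)⁷ t) = D₊(x_b⁷ t)` pointwise**: if `x_a⁴ t` lies in the
homogeneous prime of `x`, then `(x_b + m x_a)⁷t ≡ x_b⁷t`, because `x_ax_b⁶t`, `x_a²x_b⁴t`, `x_a³x_b²t`
follow `x_a⁴t` into the prime through `(x_a³x_b²t)² = (x_a⁴t)(x_a²x_b⁴t)`, `(x_a²x_b⁴t)² = (x_a⁴t)(x_b⁷t)x_b`,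
`(x_ax_b⁶t)⁴ = (x_a⁴t)(x_b⁷t)³x_b³`. [OURS · L1 W4.5c] [folklore] -/
theorem mem_basicOpen_conj_iff (hg : ∀ q, g q = X a ^ (e24 q).1 * X b ^ (e24 q).2.1 * X c ^ (e24 q).2.2)
    (m : k) (x : Proj (reesGrading (Ideal.span (Set.range g))))
    (hx0 : x ∉ Proj.basicOpen (reesGrading (Ideal.span (Set.range g))) (gT 0)) :
    x ∈ Proj.basicOpen (reesGrading (Ideal.span (Set.range g)))
        (reesT ((X b + MvPolynomial.C m * X a : MvPolynomial (Fin n) k) ^ 7) (add_C_mul_pow_seven_mem k n a b c g hg m)) ↔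
      x ∈ Proj.basicOpen (reesGrading (Ideal.span (Set.range g))) (gT 16) := by
  have hg0 : g 0 = X a ^ 4 * X b ^ 0 * X c ^ 0 := hg 0
  have hg1 : g 1 = X a ^ 3 * X b ^ 2 * X c ^ 0 := hg 1
  have hg4 : g 4 = X a ^ 2 * X b ^ 4 * X c ^ 0 := hg 4
  have hg9 : g 9 = X a ^ 1 * X b ^ 6 * X c ^ 0 := hg 9
  have hg16 : g 16 = X a ^ 0 * X b ^ 7 * X c ^ 0 := hg 16
  have hprime : x.asHomogeneousIdeal.toIdeal.IsPrime := x.isPrime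
  rw [Proj.mem_basicOpen] at hx0
  rw [Proj.mem_basicOpen, Proj.mem_basicOpen, not_iff_not]
  rw [not_not] at hx0
  change (gT 0) ∈ x.asHomogeneousIdeal.toIdeal at hx0
  change reesT _ _ ∈ x.asHomogeneousIdeal.toIdeal ↔ (gT 16) ∈ x.asHomogeneousIdeal.toIdeal
  generalize x.asHomogeneousIdeal.toIdeal = P at hprime hx0 ⊢
  -- the three certificates
  have h4 : (gT 4) ∈ P := by
    refine hprime.mem_of_pow_mem 2 ?_
    have e : (gT 4) ^ 2 = (gT 0) * (algebraMap (MvPolynomial (Fin n) k) _ (X b) * (gT 16)) := by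
      apply Subtype.ext
      simp only [Subalgebra.coe_pow, Subalgebra.coe_mul, Subalgebra.coe_algebraMap, coe_reesT,
        Polynomial.algebraMap_eq, Polynomial.monomial_pow, Polynomial.monomial_mul_monomial,
        Polynomial.C_mul_monomial, hg0, hg4, hg16]
      exact congrArg _ (by ring)
    rw [e]; exact P.mul_mem_right _ hx0
  have h1 : (gT 1) ∈ P := by
    refine hprime.mem_of_pow_mem 2 ?_
    have e : (gT 1) ^ 2 = (gT 0) * (gT 4) := by
      apply Subtype.ext
      simp only [Subalgebra.coe_pow, Subalgebra.coe_mul, coe_reesT, Polynomial.monomial_pow,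
        Polynomial.monomial_mul_monomial, hg0, hg1, hg4]
      exact congrArg _ (by ring)
    rw [e]; exact P.mul_mem_right _ hx0
  have h9 : (gT 9) ∈ P := by
    refine hprime.mem_of_pow_mem 4 ?_
    have e : (gT 9) ^ 4 =
        (gT 0) * (algebraMap (MvPolynomial (Fin n) k) _ (X b ^ 3) * ((gT 16) * ((gT 16) * (gT 16)))) := by
      apply Subtype.ext
      simp only [Subalgebra.coe_pow, Subalgebra.coe_mul, Subalgebra.coe_algebraMap, coe_reesT,
        Polynomial.algebraMap_eq, Polynomial.monomial_pow, Polynomial.monomial_mul_monomial,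
        Polynomial.C_mul_monomial, hg0, hg9, hg16]
      exact congrArg _ (by ring)
    rw [e]; exact P.mul_mem_right _ hx0
  -- the identity in Rees degree one
  have hm : ∀ u v : MvPolynomial (Fin n) k, monomial 1 u + monomial 1 v = monomial 1 (u + v) :=
    fun u v => (map_add _ u v).symm
  have hid : reesT ((X b + MvPolynomial.C m * X a : MvPolynomial (Fin n) k) ^ 7) (add_C_mul_pow_seven_mem k n a b c g hg m) =
      (gT 16) + (algebraMap (MvPolynomial (Fin n) k) _ (7 * MvPolynomial.C m) * (gT 9) +
        algebraMap (MvPolynomial (Fin n) k) _ (21 * MvPolynomial.C m ^ 2 * X b) * (gT 4) +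
        algebraMap (MvPolynomial (Fin n) k) _ (35 * MvPolynomial.C m ^ 3 * X b ^ 2) * (gT 1) +
        algebraMap (MvPolynomial (Fin n) k) _ (35 * MvPolynomial.C m ^ 4 * X b ^ 3 + 21 * MvPolynomial.C m ^ 5 * X a * X b ^ 2 +
          7 * MvPolynomial.C m ^ 6 * X a ^ 2 * X b + MvPolynomial.C m ^ 7 * X a ^ 3) * (gT 0)) := by
    apply Subtype.ext
    simp only [Subalgebra.coe_add, Subalgebra.coe_mul, Subalgebra.coe_algebraMap, coe_reesT,
      Polynomial.algebraMap_eq, Polynomial.C_mul_monomial, hm]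
    exact congrArg _ (by rw [add_C_mul_pow_seven_eq k n a b c g hg m]; ring)
  have hrest : algebraMap (MvPolynomial (Fin n) k) _ (7 * MvPolynomial.C m) * (gT 9) +
        algebraMap (MvPolynomial (Fin n) k) _ (21 * MvPolynomial.C m ^ 2 * X b) * (gT 4) +
        algebraMap (MvPolynomial (Fin n) k) _ (35 * MvPolynomial.C m ^ 3 * X b ^ 2) * (gT 1) +
        algebraMap (MvPolynomial (Fin n) k) _ (35 * MvPolynomial.C m ^ 4 * X b ^ 3 + 21 * MvPolynomial.C m ^ 5 * X a * X b ^ 2 +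
          7 * MvPolynomial.C m ^ 6 * X a ^ 2 * X b + MvPolynomial.C m ^ 7 * X a ^ 3) * (gT 0) ∈ P :=
    P.add_mem (P.add_mem (P.add_mem (P.mul_mem_left _ h9) (P.mul_mem_left _ h4)) (P.mul_mem_left _ h1))
      (P.mul_mem_left _ hx0)
  rw [hid]
  constructor
  · intro h
    simpa using P.sub_mem h hrest
  · intro h
    exact P.add_mem h hrest

end ConjChart

end Z9Peeled

end Summit.ResolutionOfSingularities.ResolutionOfSingularities.Theorems.WildQuotientResolution

end
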